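import Literature.NumberTheory.EllipticCurves.GreenbergVatsal2000.ResidualSelmerGroups
import HarnessLib

/-!
# Residual transport for the crux `SignedTransportAtTwo` (stmt-BirchSwinnertonDyer-20333, route `ThetaPartnerAtTwo`, line
# `bridge`): a `Γ_ℚ`-equivariant isomorphism `W[p] ≅ A[p]` identifies the residual cohomology groups
# `H¹(H, W[p^∞][p]) ≅ H¹(H, A[p^∞][p])` for every `H ≤ Γ_ℚ`
# (lead prover bsd-wall-tp2-p1 g3; `--supports stmt-BirchSwinnertonDyer-20333`; route-independent, closes nothing)

HONEST FRAMING. THEOREMS ONLY (no definition); nothing about any curve is asserted; BSD is not proved by any of this.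
No import of any route file.

WHAT. The crux's hypothesis is a `Γ_ℚ`-equivariant additive isomorphism `e : W[2] ≃ A[2]` of geometric `2`-torsion
(`WeierstrassCurve.geomTorsion`). Greenberg–Vatsal (p. 3: "`Sel(E/ℚ_∞)[p]` … is essentially determined by the Galois
module `E[p]`") and B. D. Kim (2009, Prop. 2.9: `S^{Σ₀,±}_{E[p]}(ℚ_∞) ≅ S^{Σ₀,±}_{E'[p]}(ℚ_∞)`) transport residual Selmer
groups along such an `e`. This file supplies the cohomological transport on the tree's objects:

* `§1` (any topological group `G`): an equivariant additive ISOMORPHISM of discrete `G`-modules induces a BIJECTION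
  `H¹(G, N) → H¹(G, N')` (`resH1Hom_id_bijective_of_addEquiv`; functoriality `resH1Hom_comp` / `resH1Hom_id`), and
  finiteness of a subgroup is equivalent to finiteness of its preimage under a bijective map
  (`finite_comap_iff_of_bijective`);
* `§2` (any number field `K`, curves `W`, `A`, prime `p`): an equivariant `W[p] ≃+ A[p]` on `geomTorsion` yields an
  equivariant `W[p^∞][p] ≃+ A[p^∞][p]` on the coefficient modules of the residual cohomology
  (`exists_equivariant_torsionBy_equiv`, "same points"), hence for
  every `H ≤ Γ_K` a bijective `pushH1 : H¹(H, W[p^∞][p]) → H¹(H, A[p^∞][p])` (`exists_pushH1_bijective`).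

With `…ResidualKummer.lean` (the Kummer bijection `H¹(ℚ_∞, E[2^∞][2]) ≅ H¹(ℚ_∞, E[2^∞])[2]` on the habitat) this places
both finiteness clauses of the registered stub `stub_sel2` of line `bridge` inside ONE group `H¹(ℚ_∞, A[2^∞][2])`; what
is left of GV Prop. (2.8) / Kim Prop. 2.9–2.12 at `p = 2` is the comparison of the two transported LOCAL conditions.

References: [GreenbergVatsal2000] p. 3, Prop. (2.8); [BDKim2009] Prop. 2.9; [SerreGaloisCohomology1997] I.§2.4.
-/

set_option autoImplicit false
-- D-0017: single-problem summit, so `Summit.BirchSwinnertonDyer.BirchSwinnertonDyer.…` repeats a namespace BY DESIGN.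
set_option linter.dupNamespace false

noncomputable section

open scoped Classical AddSubgroup

open WeierstrassCurve NumberField Literature Literature.NumberTheory.EllipticCurves
  Literature.NumberTheory.GaloisRepresentations Literature.NumberTheory.EllipticCurves.GreenbergVatsal2000

namespace Summit.BirchSwinnertonDyer.BirchSwinnertonDyer.Theorems.SignedTransportAtTwo

universe u

/-! ## §1. Equivariant isomorphisms induce bijections on `H¹` -/

section Generic

variable {G : Type u} [Group G] [TopologicalSpace G] [IsTopologicalGroup G]
variable {N : Type u} [AddCommGroup N] [DistribMulAction G N] [TopologicalSpace N] [DiscreteTopology N]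
variable {N' : Type u} [AddCommGroup N'] [DistribMulAction G N'] [TopologicalSpace N'] [DiscreteTopology N']

omit [TopologicalSpace G] [IsTopologicalGroup G] [TopologicalSpace N] [DiscreteTopology N] [TopologicalSpace N']
  [DiscreteTopology N'] in
/-- The inverse of an equivariant additive isomorphism is equivariant. [folklore] -/
theorem addEquiv_symm_smul (e : N ≃+ N') (he : ∀ (g : G) (x : N), e (g • x) = g • e x) (g : G) (y : N') :
    e.symm (g • y) = g • e.symm y :=
  e.injective (by rw [he, e.apply_symm_apply, e.apply_symm_apply])

/-- `e⁻¹_* ∘ e_* = id` on `H¹(G, ·)` for an equivariant additive isomorphism `e` (functoriality of continuous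
cohomology in compatible pairs, Mathlib `ContinuousCohomology.map_comp` / `map_id`). Serre, *Galois Cohomology*,
I.§2.4. [folklore] -/
theorem resH1Hom_symm_comp_resH1Hom (e : N ≃+ N') (he : ∀ (g : G) (x : N), e (g • x) = g • e x) :
    (resH1Hom (ContinuousMonoidHom.id G) e.symm.toAddMonoidHom (addEquiv_symm_smul e he)).comp
        (resH1Hom (ContinuousMonoidHom.id G) e.toAddMonoidHom he) =
      AddMonoidHom.id _ := by
  rw [resH1Hom_comp, ← resH1Hom_id]
  exact resH1Hom_congr rfl (by ext x; exact e.symm_apply_apply x) _ _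

/-- **An equivariant additive isomorphism of discrete `G`-modules induces a bijection `H¹(G, N) → H¹(G, N')`.**
Serre, *Galois Cohomology*, I.§2.4. [folklore] -/
theorem resH1Hom_id_bijective_of_addEquiv (e : N ≃+ N') (he : ∀ (g : G) (x : N), e (g • x) = g • e x) :
    Function.Bijective (resH1Hom (ContinuousMonoidHom.id G) e.toAddMonoidHom he) := by
  have h1 := resH1Hom_symm_comp_resH1Hom e he
  have h2 := resH1Hom_symm_comp_resH1Hom e.symm (addEquiv_symm_smul e he)
  constructor
  · exact Function.LeftInverse.injective (g := resH1Hom (ContinuousMonoidHom.id G) e.symm.toAddMonoidHom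
      (addEquiv_symm_smul e he)) fun c ↦ by
      have := DFunLike.congr_fun h1 c
      exact this
  · exact Function.RightInverse.surjective (g := resH1Hom (ContinuousMonoidHom.id G) e.symm.toAddMonoidHom
      (addEquiv_symm_smul e he)) fun c ↦ by
      have := DFunLike.congr_fun h2 c
      exact this

/-- Finiteness of a subgroup is equivalent to finiteness of its preimage under a bijective homomorphism. [folklore] -/
theorem finite_comap_iff_of_bijective {X Y : Type*} [AddCommGroup X] [AddCommGroup Y] (f : X →+ Y)
    (hf : Function.Bijective f) (S : AddSubgroup Y) :
    ((S.comap f : AddSubgroup X) : Set X).Finite ↔ (S : Set Y).Finite := by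
  constructor
  · intro h
    have himage : (S : Set Y) = f '' (S.comap f : Set X) := by
      ext y
      constructor
      · intro hy
        obtain ⟨x, rfl⟩ := hf.2 y
        exact ⟨x, hy, rfl⟩
      · rintro ⟨x, hx, rfl⟩
        exact hx
    rw [himage]
    exact h.image f
  · intro h
    rw [AddSubgroup.coe_comap]
    exact Set.Finite.preimage hf.1.injOn h

end Generic

/-! ## §2. From `W[p] ≅ A[p]` on `geomTorsion` to the residual coefficient modules and their `H¹` -/

section Curve

variable {K : Type u} [Field K] [NumberField K] (W A : WeierstrassCurve K) (p : ℕ)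

omit [NumberField K] in
/-- **An equivariant `W[p] ≃+ A[p]` (`geomTorsion`) induces an equivariant `W[p^∞][p] ≃+ A[p^∞][p]`** (the coefficient
modules of the residual cohomology; "same points", GV's `torsionToPrimary`). [cite: GreenbergVatsal2000, §2 p. 28] -/
theorem exists_equivariant_torsionBy_equiv
    (h : ∃ e : geomTorsion W (p : ℤ) ≃+ geomTorsion A (p : ℤ),
      ∀ (σ : Field.absoluteGaloisGroup K) (P : geomTorsion W (p : ℤ)), e (σ • P) = σ • e P) :
    ∃ e' : ↥((↥(W.geomPrimaryTorsion p))[(p : ℤ)]) ≃+ ↥((↥(A.geomPrimaryTorsion p))[(p : ℤ)]),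
      ∀ (σ : Field.absoluteGaloisGroup K) (x : ↥((↥(W.geomPrimaryTorsion p))[(p : ℤ)])), e' (σ • x) = σ • e' x := by
  obtain ⟨e, he⟩ := h
  -- "same points": `E[p] ≃+ E[p^∞][p]` for `E = W, A`
  have hmem : ∀ (V : WeierstrassCurve K) (x : ↥((↥(V.geomPrimaryTorsion p))[(p : ℤ)])),
      ((x : ↥(V.geomPrimaryTorsion p)) : geomPoints V) ∈ geomTorsion V (p : ℤ) := fun V x ↦ by
    have hx : (p : ℕ) • x = 0 := AddSubgroup.torsionBy.nsmul x
    have hx' : (p : ℕ) • ((x : ↥(V.geomPrimaryTorsion p)) : geomPoints V) = 0 := by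
      have h1 := congrArg (fun y : ↥((↥(V.geomPrimaryTorsion p))[(p : ℤ)]) ↦ ((y : ↥(V.geomPrimaryTorsion p)) : geomPoints V)) hx
      simpa only [AddSubgroupClass.coe_nsmul, AddSubmonoidClass.coe_nsmul, ZeroMemClass.coe_zero] using h1
    exact AddSubgroup.torsionBy.nsmul_iff.mpr hx'
  have hmem₁ : ∀ (V : WeierstrassCurve K) (P : geomTorsion V (p : ℤ)), (P : geomPoints V) ∈ V.geomPrimaryTorsion p :=
    fun V P ↦ (AddCommGroup.mem_primaryComponent (p := p)).mpr
      ⟨1, by rw [pow_one]; exact AddSubgroup.torsionBy.nsmul_iff.mp P.2⟩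
  have hmem₂ : ∀ (V : WeierstrassCurve K) (P : geomTorsion V (p : ℤ)),
      (⟨(P : geomPoints V), hmem₁ V P⟩ : ↥(V.geomPrimaryTorsion p)) ∈ (↥(V.geomPrimaryTorsion p))[(p : ℤ)] := fun V P ↦
    AddSubgroup.torsionBy.nsmul_iff.mpr (Subtype.ext (by
      rw [AddSubmonoidClass.coe_nsmul, ZeroMemClass.coe_zero]; exact AddSubgroup.torsionBy.nsmul_iff.mp P.2))
  let τ : ∀ V : WeierstrassCurve K, geomTorsion V (p : ℤ) ≃+ ↥((↥(V.geomPrimaryTorsion p))[(p : ℤ)]) := fun V ↦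
    { toFun := fun P ↦ ⟨⟨(P : geomPoints V), hmem₁ V P⟩, hmem₂ V P⟩
      invFun := fun x ↦ ⟨((x : ↥(V.geomPrimaryTorsion p)) : geomPoints V), hmem V x⟩
      left_inv := fun P ↦ Subtype.ext rfl
      right_inv := fun x ↦ Subtype.ext (Subtype.ext rfl)
      map_add' := fun P Q ↦ Subtype.ext (Subtype.ext rfl) }
  have hτ : ∀ (V : WeierstrassCurve K) (σ : Field.absoluteGaloisGroup K) (P : geomTorsion V (p : ℤ)),
      τ V (σ • P) = σ • τ V P := fun V σ P ↦ Subtype.ext (Subtype.ext rfl)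
  have hτ' : ∀ (V : WeierstrassCurve K) (σ : Field.absoluteGaloisGroup K) (x : ↥((↥(V.geomPrimaryTorsion p))[(p : ℤ)])),
      (τ V).symm (σ • x) = σ • (τ V).symm x := fun V σ x ↦
    (τ V).injective (by rw [hτ, (τ V).apply_symm_apply, (τ V).apply_symm_apply])
  refine ⟨((τ W).symm.trans e).trans (τ A), fun σ x ↦ ?_⟩
  change τ A (e ((τ W).symm (σ • x))) = σ • τ A (e ((τ W).symm x))
  rw [hτ', he, hτ]

omit [NumberField K] in
/-- **Hence a bijective `pushH1 : H¹(H, W[p^∞][p]) → H¹(H, A[p^∞][p])` for every `H ≤ Γ_K`** along an equivariant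
`W[p] ≃+ A[p]`. GV p. 3 ("essentially determined by the Galois module `E[p]`") / Kim Prop. 2.9, the cohomological half.
[cite: GreenbergVatsal2000, p. 3 and §2 p. 28] [cite: BDKim2009, Prop. 2.9] -/
theorem exists_pushH1_bijective (H : Subgroup (Field.absoluteGaloisGroup K))
    (h : ∃ e : geomTorsion W (p : ℤ) ≃+ geomTorsion A (p : ℤ),
      ∀ (σ : Field.absoluteGaloisGroup K) (P : geomTorsion W (p : ℤ)), e (σ • P) = σ • e P) :
    ∃ (e' : ↥((↥(W.geomPrimaryTorsion p))[(p : ℤ)]) ≃+ ↥((↥(A.geomPrimaryTorsion p))[(p : ℤ)]))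
      (he' : ∀ (σ : Field.absoluteGaloisGroup K) (x : ↥((↥(W.geomPrimaryTorsion p))[(p : ℤ)])), e' (σ • x) = σ • e' x),
      Function.Bijective (pushH1 H e'.toAddMonoidHom he') := by
  obtain ⟨e', he'⟩ := exists_equivariant_torsionBy_equiv W A p h
  exact ⟨e', he', resH1Hom_id_bijective_of_addEquiv (G := H) e' fun g x ↦ he' g x⟩

end Curve

end Summit.BirchSwinnertonDyer.BirchSwinnertonDyer.Theorems.SignedTransportAtTwo

end
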